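/-
Copyright (c) 2026 the pub-hodgecm-mathlib formalisation cell (harness21).  Prover seat hodgecm-mathlib-K2Liu-p01 (g8), Track B «K2-LIT»,
#184♮ = hLiu418 = `stmt-HodgeConjecture-24832`; #42S organ S1 ROAD W, F7 `K2LiuLocalSWParityOscillation` brick (H) of the LAST-FILE decomposition (bus 12:4xZ):
the socket binder `hf₀inv` — `F_Φ(h·n(t₀)) = F_Φ(h)` for `t₀` in the small box — reduced to «the Rao phase `½⟨x, c_{t₀}x⟩` lies in the conductor of `ψ` on `supp ΓΦ`».
-/
import Literature.RepresentationTheory.HeisenbergGroup.SchrodingerPiOperatorsSmooth   -- ★ `unipOpPi`, `coe_unipOpPi_apply`, `unipOpPi_eq_self_of_box`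
import HarnessLib

/-!
# Crux `HLiu418`, #42S-S1 ROAD W, brick (H): UNIPOTENT INVARIANCE OF A WITNESS FROM ITS SUPPORT —
# `r(n(c))g = g` when `½⟨x, cx⟩ ∈ cond(ψ)` on `supp g`; hence `ω(n(t₀))Φ = Φ` through an implementer `Γ`, hence `F_Φ(h·n(t₀)) = F_Φ(h)`

Cell `hodgecm-mathlib`, crux item hLiu418 = `stmt-HodgeConjecture-24832` (helper lane `--supports … --as helper`, count-neutral).  THEOREMS ONLY (no `def`, no instance,
no notation, no named-fact hypothesis, no `sorry`).  GENERIC (Schrödinger model on `𝒮(F^ι)`, any non-archimedean local `F`, any `ψ`).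

WHY (SPEC-S1-AssemblySocket row `hf₀inv`; SPEC-F7-FrameStep §1 «box integrality»).  The socket ★ F3d-CM `localDegPS_le_of_witness` wants `f₀(h·u) = f₀(h)` for `u ∈ N₀ = N_{Λ₀}`,
i.e. for `u = n(t₀)`, `t₀ ∈ Λ₀`.  By ★ `swSectionTensorLoc_mul_right`, `F_Φ(h·n(t₀)) = F_{ω(n′(t₀ ⊗ 1))Φ}(h)` (★ F4b `tensorEmbLoc_nElem`), and by ★ F4a part 1
`implementer_localOmega_nElem_apply`, `Γ(ω(n′)Φ) = r(n(c_{t₀⊗1}))(ΓΦ)` with `r(n(c))g(x) = ψ(−½⟨x, cx⟩)g(x)` (★ `coe_unipOpPi_apply`).  So `hf₀inv` IS: `ψ(½⟨x, c x⟩) = 1` on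
`supp ΓΦ = κ⁻¹(S₁²)` — which the box `Λ₀ := ϖ^{c₀}(δ̂𝕋₀)⁻¹·L` guarantees (★ (T3a) phase + ★ (i-b) trace form + integrality of `G(κx)` on `S₁²`, `c₀ = cond(ψ) + v(2) + v(d)`).  This file is
the generic reduction:
* **`unipOpPi_eq_self_of_support`** — `r(n(c))g = g` if `g` vanishes off `K` and `½⟨x, cx⟩ ∈ 𝔭^{m_ψ}` on `K` (★ `unipOpPi_eq_self_of_box` with an arbitrary support set);
* `unipOpPi_eq_self_of_forall_eq_one` — the same from `ψ(−½⟨x,cx⟩) = 1` on `supp g` directly;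
* **`eq_self_of_implementer`** — `Γ(ωΦ) = r(n(c))(ΓΦ)` and `r(n(c))(ΓΦ) = ΓΦ` ⇒ `ωΦ = Φ` (`Γ` injective);
* **`apply_mul_eq_of_rep_eq_self`** — a right-translation law `F_Φ(h·k) = F_{ρ(k)Φ}(h)` with `ρ(k)Φ = Φ` gives `F_Φ(h·k) = F_Φ(h)`; `…_of_mem` for all `k` in a set.
[MoeglinVignerasWaldspurger1987, Chap. 2 II.6, II.8] [Weil1964, n° 13 p. 160] [Kudla1994, §3 Thm. 3.1] [Rangarao1993, Lemma 3.2 (3.8) p. 351].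
HONEST LABEL.  Count-neutral helper; `HC_CM` is proved only modulo the 7 printed citations (2 remaining named inputs: hLiu418 = `stmt-HodgeConjecture-24832`,
h413 = `stmt-HodgeConjecture-24833`) until rung 0 closes.  NOT here (LAST FILE): the phase integrality on `κ⁻¹(S₁²)` for `t₀ ∈ Λ₀` (★ (T3a) + ★ (i-b) + the box (B)).

## References
* [MoeglinVignerasWaldspurger1987] C. Mœglin, M.-F. Vignéras, J.-L. Waldspurger, LNM 1291 (1987), Chap. 2 II.6, II.8.
* [Weil1964] A. Weil, *Sur certains groupes d'opérateurs unitaires*, Acta Math. 111 (1964), n° 13.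
* [Kudla1994] S. S. Kudla, Israel J. Math. 87 (1994), §3 Thm. 3.1.
* [Rangarao1993] R. Ranga Rao, Pacific J. Math. 157 (1993), Lemma 3.2.
-/

set_option autoImplicit false
set_option linter.dupNamespace false -- the mandated namespace repeats `HodgeConjecture.HodgeConjecture`

noncomputable section

namespace Summit.HodgeConjecture.HodgeConjecture.Cruxes.HLiu418.K2LiuWitnessUnipotentInvariance

open Literature.RepresentationTheory.HeisenbergGroup Literature.NumberTheory.Automorphic
open Literature.NumberTheory.GaloisRepresentations.IsNonarchimedeanLocalField

/-! ## §1 `r(n(c)) g = g` from the support -/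

section Schrodinger

variable {F : Type*} [Field F] [ValuativeRel F] [TopologicalSpace F] [IsNonarchimedeanLocalField F]
  {ι : Type*} [Fintype ι] [Invertible (2 : F)] {ψ : AddChar F Circle} (hl : IsLocallyConstant (⇑ψ : F → Circle))

/-- **`r(n(c))g = g` FROM THE SUPPORT**: if `g` vanishes off `K` and the Rao phase `½⟨x, cx⟩` lies in the conductor ball `𝔭^m` of `ψ` for `x ∈ K`, then `r(n(c))g = g`.
[cite: MoeglinVignerasWaldspurger1987, Chap. 2 II.6] [cite: Weil1964, n° 13 p. 160] -/
theorem unipOpPi_eq_self_of_support {m : ℤ} (hm : ψ.HasConductorExp m) (c : (ι → F) →ₗ[F] (ι → F)) (g : SchwartzBruhat (ι → F)) {K : Set (ι → F)}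
    (hsupp : ∀ u ∉ K, (g : (ι → F) → ℂ) u = 0) (hc : ∀ u ∈ K, halfForm c u ∈ primePowBall F m) : unipOpPi hl c g = g := by
  apply Subtype.ext
  funext u
  rw [coe_unipOpPi_apply]
  by_cases hu : u ∈ K
  · rw [hm.1 _ (neg_mem_primePowBall (hc u hu)), Circle.coe_one, one_mul]
  · rw [hsupp u hu, mul_zero]

/-- the same from `ψ(−½⟨x, cx⟩) = 1` on the support of `g`. [cite: Rangarao1993, Lemma 3.2 (3.8) p. 351] -/
theorem unipOpPi_eq_self_of_forall_eq_one (c : (ι → F) →ₗ[F] (ι → F)) (g : SchwartzBruhat (ι → F))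
    (h1 : ∀ u, (g : (ι → F) → ℂ) u ≠ 0 → ψ (-halfForm c u) = 1) : unipOpPi hl c g = g := by
  apply Subtype.ext
  funext u
  rw [coe_unipOpPi_apply]
  by_cases hu : (g : (ι → F) → ℂ) u = 0
  · rw [hu, mul_zero]
  · rw [h1 u hu, Circle.coe_one, one_mul]

/-- **THROUGH AN IMPLEMENTER**: if `Γ(ωΦ) = r(n(c))(ΓΦ)` (★ F4a part 1 `implementer_localOmega_nElem_apply`) and `r(n(c))(ΓΦ) = ΓΦ`, then `ωΦ = Φ`.
[cite: Kudla1994, §3 Thm. 3.1] -/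
theorem eq_self_of_implementer {V : Type*} [AddCommGroup V] [Module ℂ V] (Γ : V ≃ₗ[ℂ] SchwartzBruhat (ι → F)) (ω : V → V) (c : (ι → F) →ₗ[F] (ι → F)) (Φ : V)
    (hword : Γ (ω Φ) = unipOpPi hl c (Γ Φ)) (hfix : unipOpPi hl c (Γ Φ) = Γ Φ) : ω Φ = Φ :=
  Γ.injective (hword.trans hfix)

end Schrodinger

/-! ## §2 The socket binder shape -/

/-- **`F_Φ(h·k) = F_Φ(h)`** from a right-translation law `F_Φ(h·k) = F_{ρ(k)Φ}(h)` (★ `swSectionTensorLoc_mul_right`) and `ρ(k)Φ = Φ`. [cite: Kudla1994, §3] -/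
theorem apply_mul_eq_of_rep_eq_self {G V : Type*} [Mul G] (F_ : V → G → ℂ) (ρ : G → V → V) (hlaw : ∀ Φ h k, F_ Φ (h * k) = F_ (ρ k Φ) h)
    {Φ : V} {k : G} (hfix : ρ k Φ = Φ) (h : G) : F_ Φ (h * k) = F_ Φ h := by
  rw [hlaw, hfix]

/-- **the `hf₀inv` binder for a combination**: if `ρ(k)Φ_i = Φ_i` for every `k ∈ N₀` and every `i`, then `f₀ := Σ_i μ_i F_{Φ_i}` satisfies `∀ h, ∀ k ∈ N₀, f₀(h·k) = f₀(h)`.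
[cite: Kudla1994, §3] [cite: MoeglinVignerasWaldspurger1987, Chap. 2 II.6] -/
theorem sum_apply_mul_eq_of_mem {G V : Type*} [Mul G] (F_ : V → G → ℂ) (ρ : G → V → V) (hlaw : ∀ Φ h k, F_ Φ (h * k) = F_ (ρ k Φ) h)
    {ιw : Type*} (s : Finset ιw) (μc : ιw → ℂ) (Φ : ιw → V) (N₀ : Set G) (hfix : ∀ k ∈ N₀, ∀ i ∈ s, ρ k (Φ i) = Φ i) :
    ∀ h, ∀ k ∈ N₀, (∑ i ∈ s, μc i * F_ (Φ i) (h * k)) = ∑ i ∈ s, μc i * F_ (Φ i) h := by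
  intro h k hk
  exact Finset.sum_congr rfl fun i hi => by rw [apply_mul_eq_of_rep_eq_self F_ ρ hlaw (hfix k hk i hi)]

end Summit.HodgeConjecture.HodgeConjecture.Cruxes.HLiu418.K2LiuWitnessUnipotentInvariance

end
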